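import Summits.AtomisticToContinuum.FouriersLaw.Theses.JunctionLocality

/-!
# Crux `SuperadditiveResistance` (stmt-AtomisticToContinuum-11748), line `diagonal-split-series-law` —
# the CONDUCTIVITY-INCREMENT form of the registered stub `stub_evenDoubling` (lead c23, lever (x); `--supports` the crux)

Pure real analysis over an abstract response sequence `D : ℕ → ℝ` with resistances `R_N := (N−1)/D_N`
(`D_N = (N−1)·G_N` is the finite-volume Green–Kubo conductivity of the `N`-chain, ReyBellet2003 Rem 4.4 (56)).
The doubling defect of the registered stub `stub_evenDoubling` (`∃ C₁ ∀ N ≥ 2, 2R_N − C₁ ≤ R_{2N}`) is, identically,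

  `2R_N − R_{2N} = (2(N−1)(D_{2N} − D_N) − D_N) / (D_N · D_{2N})`     (`doublingDefect_eq`),

so that
* a conductance FLOOR `D_N ≥ c > 0` together with the one-sided DYADIC INCREMENT bound `D_{2N} − D_N ≤ C/N` gives the stub
  with `C₁ = 2·max C 0 / c²` (`evenDoubling_of_increment_of_floor`), and
* conversely the stub with constant `C₁` together with a conductance CEILING `0 < D_N ≤ K` gives
  `D_{2N} − D_N ≤ (max C₁ 0 · K² + K) / (2(N−1))` (`increment_le_of_evenDoubling_of_ceiling`).

Over the crux's own shell the floor for LARGE `N` is the route's crux `JunctionLocality.ConductanceLowerBound`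
(stmt-AtomisticToContinuum-11749) and positivity `D_N > 0` (`N ≥ 2`, a hypothesis of the stub) fills in the finitely many small
`N` (`floor_of_eventual_floor`); hence `stub_evenDoubling` follows BY NAME from `ConductanceLowerBound` and the shell statement
`DyadicConductivityIncrement` written inline below (`helper_evenDoublingOfIncrement`, registered helper stub).  Modulo a two-sided
`c ≤ D_N ≤ K` the stub IS the statement that the finite-volume Green–Kubo conductivity gains at most `O(1/N)` per doubling —
numerically the textbook finite-size law `κ_N = κ − a/N + …` of pinned anharmonic chains (AokiKusnezov2001, LepriLiviPoliti2003 §6);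
in the Peierls–Boltzmann slab caricature `D_L ≈ Σ_m w_m ℓ_m L/(ℓ_m + L)` the increment is `Σ_m w_m ℓ_m² L/((ℓ_m+L)(ℓ_m+2L))`,
bounded by `C/L` iff `Σ_m w_m ℓ_m² < ∞` (the census criterion, `Cruxes/SuperadditiveResistance/STRATEGY-CENSUS.md` §0).
No engine for the increment bound exists for the deterministic chain (it compares the equilibrium current autocorrelations of
two different open chains); this file only records the reformulation and its dependence on stmt-11749, kernel-checked.
References: folklore real analysis; ReyBellet2003 (finite-volume Green–Kubo formula); AokiKusnezov2001, LepriLiviPoliti2003 §6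
(finite-size corrections of pinned chains).
-/

namespace Summit.AtomisticToContinuum.FouriersLaw.Theorems.SuperadditiveResistance.DyadicIncrement

/-- **The doubling defect in conductivity variables.**  For `D_N, D_{2N} ≠ 0`:
`2(N−1)/D_N − (2N−1)/D_{2N} = (2(N−1)(D_{2N} − D_N) − D_N)/(D_N D_{2N})`. [folklore] -/
theorem doublingDefect_eq (D : ℕ → ℝ) (N : ℕ) (hN : D N ≠ 0) (h2N : D (N + N) ≠ 0) :
    2 * (((N : ℝ) - 1) / D N) - ((N : ℝ) + (N : ℝ) - 1) / D (N + N) =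
      (2 * ((N : ℝ) - 1) * (D (N + N) - D N) - D N) / (D N * D (N + N)) := by
  field_simp
  ring

/-- **Floor + dyadic increment ⇒ bounded doubling defect.**  If `D_N ≥ c > 0` and `D_{2N} − D_N ≤ C/N` for all `N ≥ 2`,
then `2R_N − 2·max C 0/c² ≤ R_{2N}` for all `N ≥ 2` (`R_N := (N−1)/D_N`). [folklore] -/
theorem evenDoubling_of_increment_of_floor (D : ℕ → ℝ) (c C : ℝ) (hc : 0 < c)
    (hfloor : ∀ N : ℕ, 2 ≤ N → c ≤ D N)
    (hinc : ∀ N : ℕ, 2 ≤ N → D (N + N) - D N ≤ C / N) :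
    ∀ N : ℕ, 2 ≤ N →
      2 * (((N : ℝ) - 1) / D N) - 2 * max C 0 / c ^ 2 ≤ ((N : ℝ) + (N : ℝ) - 1) / D (N + N) := by
  intro N hN
  have hDN : c ≤ D N := hfloor N hN
  have hD2N : c ≤ D (N + N) := hfloor (N + N) (by omega)
  have hDNpos : 0 < D N := lt_of_lt_of_le hc hDN
  have hD2Npos : 0 < D (N + N) := lt_of_lt_of_le hc hD2N
  have hNr : (2 : ℝ) ≤ N := by exact_mod_cast hN
  have hNpos : (0 : ℝ) < N := by linarith
  have hM : 0 ≤ max C 0 := le_max_right _ _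
  -- the increment bound with the nonnegative constant `max C 0`
  have hi : D (N + N) - D N ≤ max C 0 / N :=
    (hinc N hN).trans (div_le_div_of_nonneg_right (le_max_left _ _) hNpos.le)
  -- numerator bound: `2(N−1)(D_{2N} − D_N) − D_N ≤ 2·max C 0`
  have hnum : 2 * ((N : ℝ) - 1) * (D (N + N) - D N) - D N ≤ 2 * max C 0 := by
    have h1 : 2 * ((N : ℝ) - 1) * (D (N + N) - D N) ≤ 2 * ((N : ℝ) - 1) * (max C 0 / N) :=
      mul_le_mul_of_nonneg_left hi (by linarith)
    have h2 : 2 * ((N : ℝ) - 1) * (max C 0 / N) ≤ 2 * max C 0 := by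
      rw [mul_div_assoc', div_le_iff₀ hNpos]
      nlinarith
    linarith
  -- denominator bound: `c² ≤ D_N · D_{2N}`
  have hden : c ^ 2 ≤ D N * D (N + N) := by
    rw [sq]; exact mul_le_mul hDN hD2N hc.le hDNpos.le
  have hkey : 2 * (((N : ℝ) - 1) / D N) - ((N : ℝ) + (N : ℝ) - 1) / D (N + N) ≤ 2 * max C 0 / c ^ 2 := by
    rw [doublingDefect_eq D N hDNpos.ne' hD2Npos.ne',
      div_le_div_iff₀ (mul_pos hDNpos hD2Npos) (by positivity)]
    have hc2 : 0 < c ^ 2 := by positivity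
    nlinarith [mul_le_mul_of_nonneg_right hnum hc2.le, mul_le_mul_of_nonneg_left hden (by linarith : (0 : ℝ) ≤ 2 * max C 0)]
  linarith

/-- **Bounded doubling defect + ceiling ⇒ dyadic increment.**  If `2R_N − C₁ ≤ R_{2N}` and `0 < D_N ≤ K` for all `N ≥ 2`,
then `D_{2N} − D_N ≤ (max C₁ 0 · K² + K)/(2(N−1))` for all `N ≥ 2`. [folklore] -/
theorem increment_le_of_evenDoubling_of_ceiling (D : ℕ → ℝ) (C₁ K : ℝ)
    (hpos : ∀ N : ℕ, 2 ≤ N → 0 < D N) (hceil : ∀ N : ℕ, 2 ≤ N → D N ≤ K)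
    (hd : ∀ N : ℕ, 2 ≤ N → 2 * (((N : ℝ) - 1) / D N) - C₁ ≤ ((N : ℝ) + (N : ℝ) - 1) / D (N + N)) :
    ∀ N : ℕ, 2 ≤ N → D (N + N) - D N ≤ (max C₁ 0 * K ^ 2 + K) / (2 * ((N : ℝ) - 1)) := by
  intro N hN
  have hDNpos : 0 < D N := hpos N hN
  have hD2Npos : 0 < D (N + N) := hpos (N + N) (by omega)
  have hDNK : D N ≤ K := hceil N hN
  have hD2NK : D (N + N) ≤ K := hceil (N + N) (by omega)
  have hK : 0 < K := lt_of_lt_of_le hDNpos hDNK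
  have hNr : (2 : ℝ) ≤ N := by exact_mod_cast hN
  have hM : 0 ≤ max C₁ 0 := le_max_right _ _
  -- the defect bound with the nonnegative constant `max C₁ 0`, in conductivity variables
  have hdef : (2 * ((N : ℝ) - 1) * (D (N + N) - D N) - D N) / (D N * D (N + N)) ≤ max C₁ 0 := by
    rw [← doublingDefect_eq D N hDNpos.ne' hD2Npos.ne']
    have := hd N hN
    linarith [le_max_left C₁ 0]
  rw [div_le_iff₀ (mul_pos hDNpos hD2Npos)] at hdef
  -- `D_N D_{2N} ≤ K²`
  have hprod : D N * D (N + N) ≤ K ^ 2 := by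
    rw [sq]; exact mul_le_mul hDNK hD2NK hD2Npos.le hK.le
  rw [le_div_iff₀ (by linarith)]
  nlinarith [mul_le_mul_of_nonneg_left hprod hM]

/-- **An eventual floor plus pointwise positivity is a floor on `{N ≥ 2}`** (the finitely many `2 ≤ N < N₁` are absorbed
into the constant). [folklore] -/
theorem floor_of_eventual_floor (D : ℕ → ℝ) (c : ℝ) (N₁ : ℕ) (hc : 0 < c)
    (hpos : ∀ N : ℕ, 2 ≤ N → 0 < D N) (hev : ∀ N : ℕ, N₁ ≤ N → c ≤ D N) :
    ∃ c' : ℝ, 0 < c' ∧ ∀ N : ℕ, 2 ≤ N → c' ≤ D N := by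
  classical
  -- the finite set of values to undercut: `c` and `D N` for `2 ≤ N < N₁`
  let S : Finset ℝ := insert c ((Finset.Ico 2 N₁).image D)
  have hS : S.Nonempty := ⟨c, Finset.mem_insert_self _ _⟩
  refine ⟨S.min' hS, ?_, fun N hN => ?_⟩
  · -- every element of `S` is positive
    have hmem := Finset.min'_mem S hS
    rcases Finset.mem_insert.mp hmem with h | h
    · rw [h]; exact hc
    · obtain ⟨N, hN, hDN⟩ := Finset.mem_image.mp h
      rw [← hDN]
      exact hpos N (Finset.mem_Ico.mp hN).1
  · by_cases hlt : N < N₁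
    · exact Finset.min'_le S (D N)
        (Finset.mem_insert_of_mem (Finset.mem_image.mpr ⟨N, Finset.mem_Ico.mpr ⟨hN, hlt⟩, rfl⟩))
    · exact (Finset.min'_le S c (Finset.mem_insert_self _ _)).trans (hev N (not_lt.mp hlt))

/-- **`stub_evenDoubling` BY NAME from `ConductanceLowerBound` (stmt-AtomisticToContinuum-11749) and the dyadic conductivity
increment over the crux's shell.**  The second hypothesis — `DyadicConductivityIncrement`, written inline over the same shell as
the stub: `∃ C ∀ N ≥ 2, D_{2N} − D_N ≤ C/N` — is the conductivity-increment form of the stub (an alternative child statement for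
the planner acting on the line's `promote-stub`; no engine is claimed).  The conclusion is the registered signature of
`stub_evenDoubling` of `Cruxes/SuperadditiveResistance/Lines/diagonal_split_series_law.lean` verbatim. [folklore] -/
theorem helper_evenDoublingOfIncrement :
    Summit.AtomisticToContinuum.FouriersLaw.Theses.JunctionLocality.ConductanceLowerBound →
    (∀ ω₂ lam β γ : ℝ, 0 < ω₂ → 0 < lam → 0 < β → 0 < γ → (∀ (N : ℕ) (T_L T_R : ℝ), 0 < T_L → 0 < T_R → ∀ μ ν : MeasureTheory.Measure (Literature.MathematicalPhysics.KineticTheory.HeatConduction.PhaseSpace N), (Literature.MathematicalPhysics.KineticTheory.HeatConduction.pinnedChain ω₂ lam β γ).IsSteadyState N T_L T_R μ → (Literature.MathematicalPhysics.KineticTheory.HeatConduction.pinnedChain ω₂ lam β γ).IsSteadyState N T_L T_R ν → μ = ν) → ∀ μ : (N : ℕ) → ℝ → ℝ → MeasureTheory.Measure (Literature.MathematicalPhysics.KineticTheory.HeatConduction.PhaseSpace N), (∀ (N : ℕ) (T_L T_R : ℝ), 0 < T_L → 0 < T_R → (Literature.MathematicalPhysics.KineticTheory.HeatConduction.pinnedChain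 ω₂ lam β γ).IsSteadyState N T_L T_R (μ N T_L T_R)) → ∀ T : ℝ, 0 < T → ∀ D : ℕ → ℝ, (∀ N : ℕ, Filter.Tendsto (fun δ : ℝ => (Literature.MathematicalPhysics.KineticTheory.HeatConduction.pinnedChain ω₂ lam β γ).totalCurrent (μ N (T + δ / 2) (T - δ / 2)) / δ) (nhdsWithin 0 {(0 : ℝ)}ᶜ) (nhds (D N))) → (∀ N : ℕ, 2 ≤ N → 0 < D N) → ∃ C : ℝ, ∀ N : ℕ, 2 ≤ N → D (N + N) - D N ≤ C / N) →
    (∀ ω₂ lam β γ : ℝ, 0 < ω₂ → 0 < lam → 0 < β → 0 < γ → (∀ (N : ℕ) (T_L T_R : ℝ), 0 < T_L → 0 < T_R → ∀ μ ν : MeasureTheory.Measure (Literature.MathematicalPhysics.KineticTheory.HeatConduction.PhaseSpace N), (Literature.MathematicalPhysics.KineticTheory.HeatConduction.pinnedChain ω₂ lam β γ).IsSteadyState N T_L T_R μ → (Literature.MathematicalPhysics.KineticTheory.HeatConduction.pinnedChain ω₂ lam β γ).IsSteadyState N T_L T_R ν → μ = ν) → ∀ μ : (N : ℕ) → ℝ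 → ℝ → MeasureTheory.Measure (Literature.MathematicalPhysics.KineticTheory.HeatConduction.PhaseSpace N), (∀ (N : ℕ) (T_L T_R : ℝ), 0 < T_L → 0 < T_R → (Literature.MathematicalPhysics.KineticTheory.HeatConduction.pinnedChain ω₂ lam β γ).IsSteadyState N T_L T_R (μ N T_L T_R)) → ∀ T : ℝ, 0 < T → ∀ D : ℕ → ℝ, (∀ N : ℕ, Filter.Tendsto (fun δ : ℝ => (Literature.MathematicalPhysics.KineticTheory.HeatConduction.pinnedChain ω₂ lam β γ).totalCurrent (μ N (T + δ / 2) (T - δ / 2)) / δ) (nhdsWithin 0 {(0 : ℝ)}ᶜ) (nhds (D N))) → (∀ N : ℕ, 2 ≤ N → 0 < D N) → ∃ C : ℝ, ∀ N : ℕ, 2 ≤ N → 2 * (((N : ℝ) - 1) / D N) - C ≤ ((N : ℝ) + (N : ℝ) - 1) / D (N + N)) := by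
  intro hC hI ω₂ lam β γ hω hl hβ hγ hU μ hμ T hT D hD hpos
  obtain ⟨c, hc, N₁, hN₁⟩ := hC ω₂ lam β γ hω hl hβ hγ hU μ hμ T hT D hD
  obtain ⟨C, hinc⟩ := hI ω₂ lam β γ hω hl hβ hγ hU μ hμ T hT D hD hpos
  obtain ⟨c', hc', hfloor⟩ := floor_of_eventual_floor D c N₁ hc hpos hN₁
  exact ⟨2 * max C 0 / c' ^ 2, evenDoubling_of_increment_of_floor D c' C hc' hfloor hinc⟩

end Summit.AtomisticToContinuum.FouriersLaw.Theorems.SuperadditiveResistance.DyadicIncrement
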